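import Summits.BirchSwinnertonDyer.BirchSwinnertonDyer.Theorems.EisensteinPrimesFullDescentKummerSplitting
import Summits.BirchSwinnertonDyer.BirchSwinnertonDyer.Theorems.EisensteinPrimesFullDescentTateBasis
import Summits.BirchSwinnertonDyer.BirchSwinnertonDyer.Theorems.EisensteinPrimesFullDescentTateAlgebraThree
import Summits.BirchSwinnertonDyer.BirchSwinnertonDyer.Theorems.EisensteinPrimesFullDescentOrdinaryKernelRat
import Summits.BirchSwinnertonDyer.BirchSwinnertonDyer.Theorems.EisensteinPrimesLinePsiAtMultiplicativePrime
import Literature.NumberTheory.EllipticCurves.PrimaryTorsionLocalGoodReductionFrobeniusProofs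
import Literature.NumberTheory.EllipticCurves.OpenImageMazurProofs
import Literature.NumberTheory.GaloisCohomology.CyclotomicCharacterPPrimary
import Literature.NumberTheory.GaloisRepresentations.DecompositionGroupOfCompletion
import HarnessLib

/-!
# Route `EisensteinPrimes`, crux 2 `GoodLatticeBDPValue` (stmt-BirchSwinnertonDyer-19032), line `halves` v21 —
# stub 3a-B (Theorem T′), brick F8: **THEOREM B — Case `𝟙` ⇒ Case `ω`**

Cell `bsd-eis` (home `run/shared/lean/pub/bsd-eis/`), LEAD seat `bsd-line-x1-p1` (gen 5; `--supports -19032`, closes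
nothing by itself). The piece `hB` of the LEAD's assembly `FullDescentAssembly.fullDescentAtThreeOfRed_of_pieces`
(road memo `HOME/line-x1-p1-w3-g4/AN3-StubB-elementary-road.md`, §2 CASE 𝟙, steps B1–B3): for `E/ℚ` with good ORDINARY
reduction at `3`, every finite place `v ∤ 3` good or SPLIT multiplicative with residue characteristic `≡ 2 (mod 3)`, and a
`Γ_ℚ`-FIXED point `P ≠ 0` of `E[3]`, there is a point `Q ≠ 0` of `E[3]` on which `Γ_ℚ` acts through `χ̄₃` — i.e. the
extension `0 → ⟨P⟩ → E[3] → μ₃ → 0` splits. Assembly of landed bricks: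

* B1 (split `ℓ ≡ 2 (mod 3)`): the Tate basis of `E[3]` at `v` (w3 gen 4, `FullDescentTateBasis.exists_tateBasis_geomPoints_
  of_hasSplitMultiplicativeReductionAt`) and the algebra (T-a) (`FullDescentTateAlgebra.smul_eq_self_of_fixed_three`): a
  fixed `P ≠ 0` forces the local inertia group to act TRIVIALLY on `E[3]` (`χ̄₃(Frob_ℓ) = ℓ ≢ 1`, `χ̄₃` unramified at `ℓ`);
  at a good `v ∤ 3` inertia is trivial by Néron–Ogg–Shafarevich (`smul_eq_of_mem_absInertia_of_hasGoodReductionAt`);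
* B2 (at `3`): Serre's ordinary line `Λ₃` (w4 gen 6, `FullDescentOrdinaryNine.Rat.exists_ordinary_reduction_kernels_of_
  hasGoodReductionAtPrime`): stable under the decomposition group, inertia acts on it through `χ̄₃` — non-trivially
  (`Rat.exists_mem_absInertia_modNCyclotomicCharacter_absGaloisRestrict_eq` at `−1`), so `Λ₃ ∩ ⟨P⟩ = 0`;
* B3: the Kummer splitting lemma (w2 gen 5, `FullDescentKummerSplitting.exists_stable_complement`, UNCONDITIONAL) at
  `(L, N, M) = (0, ⟨P⟩, E[3])` in `V = E(ℚ̄)`, `B₃ = Λ₃`, the place-to-prime dictionary being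
  `adicCompletionPrime` / `inertia_adicCompletionPrime_eq_map_absInertia` / `GreenbergSelmer.mem_decomp_iff`;
  the `Γ_ℚ`-stable complement `B` carries `χ̄₃` by the shape `(𝟙 *; 0 χ̄₃)` of `E[3]` along `⟨P⟩`
  (`Mazur1978.smul_sub_smul_mem_zmultiples_of_isogenyCharacter` with `r = 𝟙`) and `B ∩ ⟨P⟩ = 0`.

HONEST FRAMING: helper theorems only (0 definitions, 0 named facts, 0 sorry); no summit statement, no BSD / IMC /
Keller–Yin theorem and no stub of the registered skeleton is proved by this file alone. References: [Kriz2016] Thm. 34;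
[SilvermanATAEC1994] V.3.1, Lemma V.5.2, Thm. V.5.3; [SilvermanAEC2009] VII.4.1, VIII §2; [Serre1972] §1.11 Prop. 11;
[Mazur1978] §5; [NeukirchANT1999] II §9 (9.6).
-/

set_option autoImplicit false

-- the route's Theorems namespace repeats the summit name by design (D-0017 nested layout)
set_option linter.dupNamespace false

noncomputable section

open scoped Classical NumberField

namespace Summit.BirchSwinnertonDyer.BirchSwinnertonDyer.Theorems.FullDescentTheoremB

open NumberField IsDedekindDomain Field WeierstrassCurve Rat.HeightOneSpectrum
  Literature.NumberTheory.EllipticCurves Literature.NumberTheory.GaloisRepresentations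
  Summit.BirchSwinnertonDyer.BirchSwinnertonDyer.Theorems

variable (W : WeierstrassCurve ℚ) [W.IsElliptic]

/-! ## §1. The shape `(𝟙 *; 0 χ̄₃)` of `E[3]` along a fixed point, in `E(ℚ̄)` -/

/-- For a `Γ_ℚ`-fixed `P ≠ 0` in `E[3]` and every `x ∈ E[3]`: `σ x − χ̄₃(σ) x ∈ ⟨P⟩` (as points of `E(ℚ̄)`), by the shape
`(r *; 0 χ̄ r⁻¹)` with `r = 𝟙`. [cite: Mazur1978, §5 (p. 148) and §6 proof of Prop. 6.3 (p. 153)] -/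
theorem smul_sub_chi_smul_mem_zmultiples {P : geomTorsion W ((3 : ℕ) : ℤ)} (hP0 : P ≠ 0)
    (hfix : ∀ σ : absoluteGaloisGroup ℚ, σ • P = P) (σ : absoluteGaloisGroup ℚ)
    {x : geomPoints W} (hx : x ∈ geomTorsion W ((3 : ℕ) : ℤ)) :
    σ • x - (((modNCyclotomicCharacter ℚ 3 σ : (ZMod 3)ˣ) : ZMod 3).val : ℤ) • x ∈
      AddSubgroup.zmultiples (P : geomPoints W) := by
  haveI : Fact (Nat.Prime 3) := ⟨Nat.prime_three⟩
  have hr : ∀ τ : absoluteGaloisGroup ℚ, τ • P = (((1 : absoluteGaloisGroup ℚ →* (ZMod 3)ˣ) τ : (ZMod 3)ˣ) :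
      ZMod 3).val • P := fun τ ↦ by
    rw [MonoidHom.one_apply, Units.val_one, ZMod.val_one, one_smul, hfix τ]
  have h := Mazur1978.smul_sub_smul_mem_zmultiples_of_isogenyCharacter W 3 hP0 hr σ ⟨x, hx⟩
  rw [MonoidHom.one_apply, inv_one, Units.val_one, mul_one] at h
  obtain ⟨k, hk⟩ := AddSubgroup.mem_zmultiples_iff.mp h
  refine AddSubgroup.mem_zmultiples_iff.mpr ⟨k, ?_⟩
  have hk' := congrArg (Subtype.val : geomTorsion W ((3 : ℕ) : ℤ) → geomPoints W) hk
  simp only [AddSubgroupClass.coe_sub, AddSubgroup.torsionBy.coe_smul] at hk'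
  rw [hk', natCast_zsmul]
  rfl

/-! ## §2. B1: at a split multiplicative `ℓ ≡ 2 (mod 3)`, a fixed `P ≠ 0` makes `E[3]` unramified -/

/-- **B1.** `W/ℚ` split multiplicative at the place `v` with `ℓ_v ≡ 2 (mod 3)`, `P ≠ 0` a `Γ_ℚ`-fixed point of `E[3]`:
every element of the local inertia group `I_{ℚ_v}` (restricted to `Γ_ℚ`) acts trivially on `E[3]` — Tate basis
`(P₁, P₂)` with `res τ • P₁ = χ̄₃(res τ) P₁`, `res τ • P₂ = P₂ + κ(τ) P₁`, a Frobenius has `χ̄₃ = ℓ ≢ 1`, inertia has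
`χ̄₃ = 1`, and (T-a). [cite: SilvermanATAEC1994, Thm. V.3.1 (c),(d), Lemma V.5.2, Thm. V.5.3]
[cite: NeukirchANT1999, Ch. I §10 (10.3), Ch. II §9 Prop. (9.6)] -/
theorem smul_eq_of_mem_absInertia_of_split_of_fixed {v : HeightOneSpectrum (𝓞 ℚ)} (hv3 : natGenerator v ≠ 3)
    (hsplit : W.HasSplitMultiplicativeReductionAt v) (hmod : natGenerator v % 3 = 2)
    {P : geomPoints W} (hP3 : ((3 : ℕ) : ℤ) • P = 0) (hP0 : P ≠ 0) (hfix : ∀ σ : absoluteGaloisGroup ℚ, σ • P = P)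
    {τ : absoluteGaloisGroup (v.adicCompletion ℚ)} (hτ : τ ∈ absInertia (v.adicCompletion ℚ))
    {x : geomPoints W} (hx : ((3 : ℕ) : ℤ) • x = 0) :
    absGaloisRestrict ℚ (v.adicCompletion ℚ) τ • x = x := by
  haveI : Fact (Nat.Prime 3) := ⟨Nat.prime_three⟩
  haveI hℓ : Fact (primesEquiv v : ℕ).Prime := ⟨(primesEquiv v).2⟩
  have hv : ((primesEquiv v : Nat.Primes) : ℕ) = natGenerator v := rfl
  -- the Tate basis of `E[3]`
  obtain ⟨P₁, P₂, κ, -, -, hgen, hrel, hP₁, hP₂⟩ :=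
    FullDescentTateBasis.exists_tateBasis_geomPoints_of_hasSplitMultiplicativeReductionAt W v hsplit (N := 3)
  -- the composite action of `Γ_{ℚ_v}` on `E(ℚ̄)` through `res`
  letI inst : DistribMulAction (absoluteGaloisGroup (v.adicCompletion ℚ)) (geomPoints W) :=
    DistribMulAction.compHom _ (absGaloisRestrict ℚ (v.adicCompletion ℚ)).toMonoidHom
  have hdef : ∀ (σ : absoluteGaloisGroup (v.adicCompletion ℚ)) (y : geomPoints W),
      σ • y = absGaloisRestrict ℚ (v.adicCompletion ℚ) σ • y := fun _ _ ↦ rfl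
  set χ : absoluteGaloisGroup (v.adicCompletion ℚ) → ℤ := fun σ ↦
    (((modNCyclotomicCharacter ℚ 3 (absGaloisRestrict ℚ (v.adicCompletion ℚ) σ) : (ZMod 3)ˣ) : ZMod 3).val : ℤ)
    with hχ
  set κ' : absoluteGaloisGroup (v.adicCompletion ℚ) → ℤ := fun σ ↦ (κ σ : ℤ) with hκ'
  have hgen' : ∀ Q : geomPoints W, (3 : ℤ) • Q = 0 → ∃ a b : ℤ, Q = a • P₁ + b • P₂ := fun Q hQ ↦
    hgen Q (by simpa using hQ)
  have hrel' : ∀ a b : ℤ, a • P₁ + b • P₂ = 0 ↔ (3 : ℤ) ∣ a ∧ (3 : ℤ) ∣ b := fun a b ↦ by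
    simpa using hrel a b
  have hP₁' : ∀ σ : absoluteGaloisGroup (v.adicCompletion ℚ), σ • P₁ = χ σ • P₁ := fun σ ↦ by
    rw [hdef, hP₁ σ, hχ, natCast_zsmul]
  have hP₂' : ∀ σ : absoluteGaloisGroup (v.adicCompletion ℚ), σ • P₂ = P₂ + κ' σ • P₁ := fun σ ↦ by
    rw [hdef, hP₂ σ, hκ', natCast_zsmul]
  -- a Frobenius: `χ̄₃(res σ₀) = ℓ ≡ 2`
  obtain ⟨𝔐, h𝔐⟩ := v.localPrimesAbove_nonempty
  obtain ⟨σ₀, hσ₀⟩ := IsDedekindDomain.HeightOneSpectrum.exists_isArithFrobAt_localAbsIntegers v h𝔐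
  have hℓ3 : ¬ natGenerator v ∣ 3 := fun h ↦
    hv3 ((Nat.prime_dvd_prime_iff_eq (prime_natGenerator v) Nat.prime_three).mp h)
  have hχσ₀ : χ σ₀ = 2 := by
    have h := EisensteinPrimesLinePsiAtMultiplicativePrime.modNCyclotomicCharacter_absGaloisRestrict_frob
      (p := natGenerator v) hv h𝔐 hσ₀ 3 hℓ3
    simp only [hχ]
    rw [h, ZMod.val_natCast, hmod]
    rfl
  have hσ₀' : ¬ (3 : ℤ) ∣ χ σ₀ - 1 := by rw [hχσ₀]; decide
  -- inertia: `χ̄₃(res τ) = 1`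
  have h3v : ((3 : ℕ) : 𝓞 ℚ) ∉ v.asIdeal := fun h ↦ hℓ3 ((Rat.natCast_mem_asIdeal_iff v).mp h)
  haveI : NeZero ((3 : ℕ) : ℚ) := ⟨by norm_num⟩
  have hχτ : (3 : ℤ) ∣ χ τ - 1 := by
    have h := Literature.NumberTheory.GaloisCohomology.modNCyclotomicCharacter_absGaloisRestrict_eq_one_of_mem_absInertia
      ℚ 3 v h3v hτ
    simp only [hχ]
    rw [h, Units.val_one, ZMod.val_one]
    simp
  have hfix' : ∀ σ : absoluteGaloisGroup (v.adicCompletion ℚ), σ • P = P := fun σ ↦ by rw [hdef, hfix]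
  have key := FullDescentTateAlgebra.smul_eq_self_of_fixed_three hgen' hrel' hP₁' hP₂' hσ₀'
    (by simpa using hP3) hP0 hfix' hχτ (x := x) (by simpa using hx)
  rwa [hdef] at key

/-! ## §3. Theorem B -/

/-- **Theorem B (AN-3 road, Case `𝟙` ⇒ Case `ω`).** `W/ℚ` globally minimal with good ORDINARY reduction at `3`; every
finite place `v ∤ 3` good, or split multiplicative with residue characteristic `≡ 2 (mod 3)`; `P ≠ 0` a `Γ_ℚ`-fixed
point of `E[3]`. Then some `Q ≠ 0` in `E[3]` carries the character `χ̄₃` (`σ Q = χ̄₃(σ) Q`): the sequence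
`0 → ⟨P⟩ → E[3] → μ₃ → 0` splits over `Γ_ℚ` — Kummer splitting (`FullDescentKummerSplitting.exists_stable_complement`) fed
with B1 (`smul_eq_of_mem_absInertia_of_split_of_fixed`, Néron–Ogg–Shafarevich at the good places) and B2 (Serre's
ordinary line `Λ₃`, which meets `⟨P⟩` trivially since inertia acts on it through `χ̄₃ ≠ 𝟙`).
[cite: Kriz2016, Thm. 34 (2)–(3)] [cite: Serre1972, §1.11 Prop. 11] [cite: SilvermanAEC2009, VIII §2 (Kummer pairing)] -/
theorem exists_omega_point_of_fixed_point [W.IsGloballyMinimal]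
    (h3 : W.HasGoodReductionAtPrime 3) (hord : ¬ (3 : ℤ) ∣ W.frobeniusTrace 3)
    (hH : ∀ v : HeightOneSpectrum (𝓞 ℚ), natGenerator v ≠ 3 →
      W.HasGoodReductionAt v ∨ (W.HasSplitMultiplicativeReductionAt v ∧ natGenerator v % 3 = 2))
    (P : geomTorsion W ((3 : ℕ) : ℤ)) (hP0 : P ≠ 0) (hfix : ∀ σ : absoluteGaloisGroup ℚ, σ • P = P) :
    ∃ Q : geomTorsion W ((3 : ℕ) : ℤ), Q ≠ 0 ∧
      ∀ σ : absoluteGaloisGroup ℚ, σ • Q = ((modNCyclotomicCharacter ℚ 3 σ : (ZMod 3)ˣ) : ZMod 3).val • Q := by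
  haveI : Fact (Nat.Prime 3) := ⟨Nat.prime_three⟩
  have hP0' : (P : geomPoints W) ≠ 0 := fun h ↦ hP0 (Subtype.ext h)
  have hPM : (P : geomPoints W) ∈ geomTorsion W ((3 : ℕ) : ℤ) := P.2
  have hP3 : ((3 : ℕ) : ℤ) • (P : geomPoints W) = 0 := mem_torsionBy_iff.mp P.2
  have hfixc : ∀ σ : absoluteGaloisGroup ℚ, σ • (P : geomPoints W) = P := fun σ ↦ by
    rw [← AddSubgroup.torsionBy.coe_smul, hfix σ]
  have hNM : AddSubgroup.zmultiples (P : geomPoints W) ≤ geomTorsion W ((3 : ℕ) : ℤ) :=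
    AddSubgroup.zmultiples_le_of_mem hPM
  -- cardinalities
  have hcN : Nat.card (AddSubgroup.zmultiples (P : geomPoints W)) = 3 * 1 := by
    rw [Nat.card_zmultiples, AddSubgroup.addOrderOf_coe, addOrderOf_eq_of_ne_zero W 3 hP0]
  have hcM : Nat.card (geomTorsion W ((3 : ℕ) : ℤ)) = 9 * 1 := by
    rw [Literature.NumberTheory.EllipticCurves.natCard_geomTorsion W 3]; rfl
  -- the place above `3` and Serre's line there
  obtain ⟨v₃, hv₃'⟩ : ∃ v₃ : HeightOneSpectrum (𝓞 ℚ), primesEquiv v₃ = ⟨3, Nat.prime_three⟩ :=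
    ⟨(primesEquiv (R := 𝓞 ℚ)).symm ⟨3, Nat.prime_three⟩, Equiv.apply_symm_apply _ _⟩
  have hv₃ : natGenerator v₃ = 3 := congrArg Subtype.val hv₃'
  have h3v₃ : ((3 : ℕ) : 𝓞 ℚ) ∈ v₃.asIdeal := (Rat.natCast_mem_asIdeal_iff v₃).mpr (hv₃ ▸ dvd_refl _)
  obtain ⟨Λ, K₂, hΛle, hΛcard, -, -, -, hΛst, -, -, -, -, hΛχ, -⟩ :=
    FullDescentOrdinaryNine.Rat.exists_ordinary_reduction_kernels_of_hasGoodReductionAtPrime W 3 (by norm_num) h3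
      hord v₃ h3v₃
  -- `Λ ∩ ⟨P⟩ = 0`: inertia acts on `Λ` through `χ̄₃`, with the value `−1` attained, but fixes `P`
  have hΛN : Λ ⊓ AddSubgroup.zmultiples (P : geomPoints W) = ⊥ := by
    rw [eq_bot_iff]
    intro x hx
    obtain ⟨hxΛ, hxN⟩ := AddSubgroup.mem_inf.mp hx
    obtain ⟨τ, hτ, hτχ⟩ :=
      FullDescentOrdinaryNine.Rat.exists_mem_absInertia_modNCyclotomicCharacter_absGaloisRestrict_eq 3 v₃ h3v₃ (-1)
    have h1 := hΛχ τ hτ x hxΛ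
    rw [hτχ] at h1
    have hxfix : absGaloisRestrict ℚ (v₃.adicCompletion ℚ) τ • x = x := by
      obtain ⟨k, rfl⟩ := AddSubgroup.mem_zmultiples_iff.mp hxN
      rw [FullDescentTateAlgebra.smul_zsmul_comm, hfixc]
    rw [hxfix, show (((-1 : (ZMod 3)ˣ) : ZMod 3)).val = 2 from rfl, two_nsmul] at h1
    rw [AddSubgroup.mem_bot]
    exact left_eq_add.mp h1
  -- the Kummer splitting lemma at `(0, ⟨P⟩, E[3])`
  obtain ⟨B, -, hBM, hBN, hNB, hBst⟩ := FullDescentKummerSplitting.exists_stable_complement (V := geomPoints W)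
    ⊥ (AddSubgroup.zmultiples (P : geomPoints W)) (geomTorsion W ((3 : ℕ) : ℤ)) bot_le hNM one_ne_zero
    (by simp) hcN hcM
    (fun σ x hx ↦ by rw [(AddSubgroup.mem_bot).mp hx, smul_zero]; exact AddSubgroup.zero_mem _)
    (fun x hx ↦ by
      rw [AddSubgroup.mem_bot]
      have h : ((3 : ℕ) : ℤ) • x = 0 := mem_torsionBy_iff.mp hx
      rwa [Nat.cast_ofNat] at h)
    (fun σ x hx ↦ by
      obtain ⟨k, rfl⟩ := AddSubgroup.mem_zmultiples_iff.mp hx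
      rw [FullDescentTateAlgebra.smul_zsmul_comm, hfixc, sub_self]
      exact AddSubgroup.zero_mem _)
    (fun σ x hx ↦ smul_sub_chi_smul_mem_zmultiples W hP0 hfix σ hx)
    (fun x _ ↦ W.isOpen_stabilizer_point_holds x)
    (fun v hv ↦ by
      refine ⟨adicCompletionPrime ℚ v, adicCompletionPrime_mem_primesAbove ℚ v, fun τ hτ x hx ↦ ?_⟩
      rw [inertia_adicCompletionPrime_eq_map_absInertia ℚ v] at hτ
      obtain ⟨τ', hτ', rfl⟩ := Subgroup.mem_map.mp hτ
      rw [AddSubgroup.mem_bot, sub_eq_zero]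
      have hx3 : ((3 : ℕ) : ℤ) • x = 0 := mem_torsionBy_iff.mp hx
      rcases hH v hv with hgood | ⟨hsplit, hmod⟩
      · have hn : ((((3 : ℕ) : ℤ)) : 𝓞 ℚ) ∉ v.asIdeal := by
          rw [Int.cast_natCast]
          exact fun h ↦ hv (((Nat.prime_dvd_prime_iff_eq (prime_natGenerator v) Nat.prime_three).mp
            ((Rat.natCast_mem_asIdeal_iff v).mp h)))
        exact W.smul_eq_of_mem_absInertia_of_hasGoodReductionAt hgood hn hτ' hx3
      · exact smul_eq_of_mem_absInertia_of_split_of_fixed W hv hsplit hmod hP3 hP0' hfixc hτ' hx3)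
    hv₃
    ⟨Λ, bot_le, hΛle, by rw [hΛcard]; rfl, hΛN, fun δ hδ x hx ↦ by
      obtain ⟨σ, rfl⟩ := (GreenbergSelmer.mem_decomp_iff v₃ δ).mp hδ
      exact hΛst σ x hx⟩
  -- `B ≠ 0`: otherwise `⟨P⟩ = E[3]`, of order `3 ≠ 9`
  have hB0 : B ≠ ⊥ := by
    rintro rfl
    rw [sup_bot_eq] at hNB
    have h := congrArg (fun S : AddSubgroup (geomPoints W) ↦ Nat.card S) hNB
    simp only [hcN, hcM] at h
    omega
  obtain ⟨⟨q, hqB⟩, hq0⟩ := (AddSubgroup.ne_bot_iff_exists_ne_zero).mp hB0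
  have hq0' : q ≠ 0 := fun h ↦ hq0 (Subtype.ext h)
  refine ⟨⟨q, hBM hqB⟩, fun h ↦ hq0' (congrArg Subtype.val h), fun σ ↦ Subtype.ext ?_⟩
  -- `σ q − χ̄₃(σ) q ∈ B ∩ ⟨P⟩ = 0`
  have hmemN := smul_sub_chi_smul_mem_zmultiples W hP0 hfix σ (hBM hqB)
  have hmemB : σ • q - (((modNCyclotomicCharacter ℚ 3 σ : (ZMod 3)ˣ) : ZMod 3).val : ℤ) • q ∈ B :=
    B.sub_mem (hBst σ q hqB) (B.zsmul_mem hqB _)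
  have h0 : σ • q - (((modNCyclotomicCharacter ℚ 3 σ : (ZMod 3)ˣ) : ZMod 3).val : ℤ) • q = 0 := by
    rw [← AddSubgroup.mem_bot, ← hBN]
    exact AddSubgroup.mem_inf.mpr ⟨hmemB, hmemN⟩
  rw [sub_eq_zero, natCast_zsmul] at h0
  rw [AddSubgroup.torsionBy.coe_smul, AddSubgroupClass.coe_nsmul]
  exact h0

end Summit.BirchSwinnertonDyer.BirchSwinnertonDyer.Theorems.FullDescentTheoremB

end
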